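import Mathlib
import HarnessLib
import Literature.AlgebraicGeometry.Ramification.InertiaNormalSylow
import Literature.AlgebraicGeometry.Resolution.ResolutionOfSingularities
import Summits.ResolutionOfSingularities.ResolutionOfSingularities.Theses.WildQuotients

/-!
# The p-closed case of Phase 0, and what the transfer stub contains (crux `WildQuotients.WildQuotientResolution`, line `Sketch`)

Helpers for the skeleton `Sketch` of crux stmt-ResolutionOfSingularities-15640 (route
`ResolutionOfSingularities/WildQuotients`, card `p-closure-sylow-separation`), supporting the two
open stubs `stub_phaseZero` (Phase 0, "Sylow separation": a `G`-equivariant proper birational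
REGULAR model `π : X♯ → X′` on which every inertia group — Abbes–Saito 2011, 2.4, the tree's
`Literature.AlgebraicGeometry.Ramification.inertiaSubgroup` — has a normal Sylow `p`-subgroup, with
a `G`-stable affine cover) and `stub_pClosedModel` (the transfer: crux data + such a model ⇒
`Scheme.HasResolution X₁`).

* `exists_isAffineOpen_stable` — for `q : X′ → X₁` affine (e.g. finite) and `G` acting on `X′`
  over `X₁` (`ρ g ≫ q = q`), every point of `X′` has a `G`-STABLE affine open neighbourhood,
  namely `q⁻¹(W)` for an affine open `W ∋ q x` of `X₁`. (Mumford's hypothesis for the quotient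
  `X′/G`, free upstairs.)
* `phaseZero_of_forall_hasNormalSylow` — **Phase 0 is vacuous when every inertia group is already
  p-closed**: the trivial model `X♯ = X′`, `π = 𝟙`, `ρ♯ = ρ` has all seven properties demanded by
  `stub_phaseZero`. `phaseZero_of_hasNormalSylow`: in particular when `G` itself has a normal
  Sylow `p`-subgroup (a `p`-group, a group of order prime to `p`, …), since subgroups inherit a
  normal Sylow (`HasNormalSylow.subgroup`).
* `hasResolution_of_pClosedModel_of_forall_hasNormalSylow` / `…_of_hasNormalSylow` — consequently the transfer stub
  `stub_pClosedModel` (its registered signature, taken verbatim as the hypothesis `hstub`) ALONE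
  proves the crux for every action all of whose inertia groups are p-closed; specialised:
  `cyclicWildQuotient_of_pClosedModel` (`hstub → CyclicWildQuotient`, the route's OPEN wild atom
  stmt-ResolutionOfSingularities-15644: `G` of order `p` is a `p`-group),
  `hasResolution_of_pClosedModel_of_coprime` (`|G|` prime to `p`, over EVERY field) and
  `tameQuotientResolution_of_pClosedModel` (`hstub → TameQuotientResolution`, stmt-15645).
  These are the Lean certificates behind the lead's verdict that `stub_pClosedModel` is
  crux-sized (it contains two open/unproved route items) and should be promoted to an item
  "WQ for actions with p-closed inertia" rather than proved inside the line.

No blow-up geometry is used; everything here is the identity model plus group theory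
(`HasNormalSylow.of_isPGroup`, `.of_not_dvd_card`, `.subgroup`).
-/

-- single-problem summit: the doubled namespace component `ResolutionOfSingularities` is forced
set_option linter.dupNamespace false

namespace Summit.ResolutionOfSingularities.ResolutionOfSingularities.Theorems.WildQuotientResolution.PClosedCase

open CategoryTheory AlgebraicGeometry TopologicalSpace
open Literature.AlgebraicGeometry.Resolution Literature.AlgebraicGeometry.Ramification
open Summit.ResolutionOfSingularities.ResolutionOfSingularities.Theses.WildQuotients

/-! ## `G`-stable affine neighbourhoods upstairs -/

/-- **`G`-stable affine neighbourhoods** (Mumford's hypothesis upstairs, for free): if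
`q : X′ → X₁` is an affine morphism and `G` acts on `X′` over `X₁` (`ρ g ≫ q = q`), then every
`x ∈ X′` lies in a `G`-stable affine open, namely `q⁻¹(W)` for an affine open `W ∋ q x`.
[folklore; cf. MumfordAV1970 §7] -/
theorem exists_isAffineOpen_stable {X' X₁ : Scheme.{0}} (q : X' ⟶ X₁) [IsAffineHom q]
    {G : Type} [Group G] (ρ : G →* Aut X') (hρ : ∀ g : G, (ρ g).hom ≫ q = q) (x : X') :
    ∃ U : X'.Opens, IsAffineOpen U ∧ x ∈ U ∧ ∀ g : G, (ρ g).hom ⁻¹ᵁ U = U := by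
  obtain ⟨W, hW, hxW, -⟩ :=
    exists_isAffineOpen_mem_and_subset (X := X₁) (x := q.base x) (U := ⊤) trivial
  refine ⟨q ⁻¹ᵁ W, hW.preimage q, hxW, fun g => ?_⟩
  change ((ρ g).hom ≫ q) ⁻¹ᵁ W = q ⁻¹ᵁ W
  rw [hρ g]

/-! ## Phase 0 is vacuous when the inertia groups are already p-closed -/

/-- **Phase 0, p-closed case**: if every inertia group of the action `ρ` of `G` on the regular
integral `X′` (affine over `X₁` through the `G`-invariant `q`) already has a normal Sylow
`p`-subgroup, then the identity `X♯ = X′`, `π = 𝟙`, `ρ♯ = ρ` is a model with all the properties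
`stub_phaseZero` asks for: proper, birational, integral, regular, equivariant, p-closed inertia,
`G`-stable affine cover (`exists_isAffineOpen_stable`). [folklore] -/
theorem phaseZero_of_forall_hasNormalSylow (p : ℕ) {X' X₁ : Scheme.{0}} (q : X' ⟶ X₁)
    [IsAffineHom q] {G : Type} [Group G] (ρ : G →* Aut X') [IsIntegral X']
    (hreg : Scheme.IsRegular X') (hρ : ∀ g : G, (ρ g).hom ≫ q = q)
    (hI : ∀ x : X', HasNormalSylow p (inertiaSubgroup ρ x)) :
    ∃ (Xs : Scheme.{0}) (π : Xs ⟶ X') (ρs : G →* Aut Xs), IsProper π ∧ IsBirational π ∧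
      IsIntegral Xs ∧ Scheme.IsRegular Xs ∧ (∀ g : G, (ρs g).hom ≫ π = π ≫ (ρ g).hom) ∧
      (∀ x : Xs, HasNormalSylow p (inertiaSubgroup ρs x)) ∧
      ∀ x : Xs, ∃ U : Xs.Opens, IsAffineOpen U ∧ x ∈ U ∧ ∀ g : G, (ρs g).hom ⁻¹ᵁ U = U :=
  ⟨X', 𝟙 X', ρ, inferInstance, ⟨⊤, by simp, by simp, inferInstance⟩, inferInstance, hreg,
    fun g => by simp, hI, exists_isAffineOpen_stable q ρ hρ⟩

/-- **Phase 0 is vacuous for a p-closed group**: if `G` itself has a normal Sylow `p`-subgroup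
(e.g. `G` a `p`-group, or of order prime to `p`), so does every inertia group
(`HasNormalSylow.subgroup`), and the identity model does the job. [folklore] -/
theorem phaseZero_of_hasNormalSylow (p : ℕ) [Fact p.Prime] {X' X₁ : Scheme.{0}} (q : X' ⟶ X₁)
    [IsAffineHom q] {G : Type} [Group G] [Finite G] (ρ : G →* Aut X') [IsIntegral X']
    (hreg : Scheme.IsRegular X') (hρ : ∀ g : G, (ρ g).hom ≫ q = q) (hG : HasNormalSylow p G) :
    ∃ (Xs : Scheme.{0}) (π : Xs ⟶ X') (ρs : G →* Aut Xs), IsProper π ∧ IsBirational π ∧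
      IsIntegral Xs ∧ Scheme.IsRegular Xs ∧ (∀ g : G, (ρs g).hom ≫ π = π ≫ (ρ g).hom) ∧
      (∀ x : Xs, HasNormalSylow p (inertiaSubgroup ρs x)) ∧
      ∀ x : Xs, ∃ U : Xs.Opens, IsAffineOpen U ∧ x ∈ U ∧ ∀ g : G, (ρs g).hom ⁻¹ᵁ U = U :=
  phaseZero_of_forall_hasNormalSylow p q ρ hreg hρ fun _ => hG.subgroup _

/-! ## What the transfer stub contains

The hypothesis `hstub` below is the registered signature of `stub_pClosedModel` (skeleton `Sketch`,
sha ee3bad20…), universally closed, verbatim. -/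

/-- **The transfer stub proves the crux for p-closed inertia.** If `stub_pClosedModel` holds
(hypothesis `hstub`, its registered signature verbatim) then every Galois-type quotient `X₁` of a
regular integral `X′` by `G` ALL OF WHOSE INERTIA GROUPS have a normal Sylow `p`-subgroup has a
resolution — feed the stub the identity model (`phaseZero_of_forall_hasNormalSylow`). [folklore] -/
theorem hasResolution_of_pClosedModel_of_forall_hasNormalSylow
    (hstub : ∀ (p : ℕ) (_ : p.Prime) (k : Type) [Field k] [CharP k p] (X' X₁ : Scheme.{0})
      (f : X₁ ⟶ Spec (.of k)) (q : X' ⟶ X₁) (G : Type) [Group G] [Finite G] (ρ : G →* Aut X'),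
      IsSeparated f → LocallyOfFiniteType f → QuasiCompact f → IsIntegral X₁ → IsIntegral X' →
      Scheme.IsRegular X' → IsFinite q → Function.Surjective q.base →
      (∃ U : X₁.Opens, Dense (U : Set X₁) ∧ Etale (q ∣_ U)) → (∀ g : G, (ρ g).hom ≫ q = q) →
      (∀ x y : X', q.base x = q.base y → ∃ g : G, (ρ g).hom.base x = y) →
      ∀ (Xs : Scheme.{0}) (π : Xs ⟶ X') (ρs : G →* Aut Xs), IsProper π → IsBirational π →
      IsIntegral Xs → Scheme.IsRegular Xs → (∀ g : G, (ρs g).hom ≫ π = π ≫ (ρ g).hom) →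
      (∀ x : Xs, HasNormalSylow p (inertiaSubgroup ρs x)) →
      (∀ x : Xs, ∃ U : Xs.Opens, IsAffineOpen U ∧ x ∈ U ∧ ∀ g : G, (ρs g).hom ⁻¹ᵁ U = U) →
      Scheme.HasResolution X₁)
    (p : ℕ) (hp : p.Prime) (k : Type) [Field k] [CharP k p] (X' X₁ : Scheme.{0})
    (f : X₁ ⟶ Spec (.of k)) (q : X' ⟶ X₁) (G : Type) [Group G] [Finite G] (ρ : G →* Aut X')
    (hsep : IsSeparated f) (hft : LocallyOfFiniteType f) (hqc : QuasiCompact f)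
    (hX₁ : IsIntegral X₁) (hX' : IsIntegral X') (hreg : Scheme.IsRegular X') (hq : IsFinite q)
    (hsurj : Function.Surjective q.base)
    (hU : ∃ U : X₁.Opens, Dense (U : Set X₁) ∧ Etale (q ∣_ U))
    (hρ : ∀ g : G, (ρ g).hom ≫ q = q)
    (horb : ∀ x y : X', q.base x = q.base y → ∃ g : G, (ρ g).hom.base x = y)
    (hI : ∀ x : X', HasNormalSylow p (inertiaSubgroup ρ x)) :
    Scheme.HasResolution X₁ := by
  haveI := hX'; haveI := hq
  obtain ⟨Xs, π, ρs, hπ, hbir, hXs, hXsreg, hequiv, hNpS, hcov⟩ :=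
    phaseZero_of_forall_hasNormalSylow p q ρ hreg hρ hI
  exact hstub p hp k X' X₁ f q G ρ hsep hft hqc hX₁ hX' hreg hq hsurj hU hρ horb Xs π ρs hπ hbir
    hXs hXsreg hequiv hNpS hcov

/-- **The transfer stub proves the crux for a p-closed group** `G` (one with a normal Sylow
`p`-subgroup): feed it the identity model of `phaseZero_of_hasNormalSylow`. [folklore] -/
theorem hasResolution_of_pClosedModel_of_hasNormalSylow
    (hstub : ∀ (p : ℕ) (_ : p.Prime) (k : Type) [Field k] [CharP k p] (X' X₁ : Scheme.{0})
      (f : X₁ ⟶ Spec (.of k)) (q : X' ⟶ X₁) (G : Type) [Group G] [Finite G] (ρ : G →* Aut X'),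
      IsSeparated f → LocallyOfFiniteType f → QuasiCompact f → IsIntegral X₁ → IsIntegral X' →
      Scheme.IsRegular X' → IsFinite q → Function.Surjective q.base →
      (∃ U : X₁.Opens, Dense (U : Set X₁) ∧ Etale (q ∣_ U)) → (∀ g : G, (ρ g).hom ≫ q = q) →
      (∀ x y : X', q.base x = q.base y → ∃ g : G, (ρ g).hom.base x = y) →
      ∀ (Xs : Scheme.{0}) (π : Xs ⟶ X') (ρs : G →* Aut Xs), IsProper π → IsBirational π →
      IsIntegral Xs → Scheme.IsRegular Xs → (∀ g : G, (ρs g).hom ≫ π = π ≫ (ρ g).hom) →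
      (∀ x : Xs, HasNormalSylow p (inertiaSubgroup ρs x)) →
      (∀ x : Xs, ∃ U : Xs.Opens, IsAffineOpen U ∧ x ∈ U ∧ ∀ g : G, (ρs g).hom ⁻¹ᵁ U = U) →
      Scheme.HasResolution X₁)
    (p : ℕ) (hp : p.Prime) (k : Type) [Field k] [CharP k p] (X' X₁ : Scheme.{0})
    (f : X₁ ⟶ Spec (.of k)) (q : X' ⟶ X₁) (G : Type) [Group G] [Finite G] (ρ : G →* Aut X')
    (hG : haveI : Fact p.Prime := ⟨hp⟩; HasNormalSylow p G)
    (hsep : IsSeparated f) (hft : LocallyOfFiniteType f) (hqc : QuasiCompact f)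
    (hX₁ : IsIntegral X₁) (hX' : IsIntegral X') (hreg : Scheme.IsRegular X') (hq : IsFinite q)
    (hsurj : Function.Surjective q.base)
    (hU : ∃ U : X₁.Opens, Dense (U : Set X₁) ∧ Etale (q ∣_ U))
    (hρ : ∀ g : G, (ρ g).hom ≫ q = q)
    (horb : ∀ x y : X', q.base x = q.base y → ∃ g : G, (ρ g).hom.base x = y) :
    Scheme.HasResolution X₁ := by
  haveI : Fact p.Prime := ⟨hp⟩
  haveI := hX'; haveI := hq
  obtain ⟨Xs, π, ρs, hπ, hbir, hXs, hXsreg, hequiv, hNpS, hcov⟩ :=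
    phaseZero_of_hasNormalSylow p q ρ hreg hρ hG
  exact hstub p hp k X' X₁ f q G ρ hsep hft hqc hX₁ hX' hreg hq hsurj hU hρ horb Xs π ρs hπ hbir
    hXs hXsreg hequiv hNpS hcov

/-- **`stub_pClosedModel` contains the wild atom**: the transfer stub (hypothesis `hstub`, its
registered signature verbatim) implies the route item `CyclicWildQuotient`
(stmt-ResolutionOfSingularities-15644, OPEN from dimension 4): a group of order `p` is a `p`-group,
so all its subgroups — in particular all inertia groups — have a normal Sylow `p`-subgroup, and
`hasResolution_of_pClosedModel_of_forall_hasNormalSylow` applies. [folklore] -/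
theorem cyclicWildQuotient_of_pClosedModel
    (hstub : ∀ (p : ℕ) (_ : p.Prime) (k : Type) [Field k] [CharP k p] (X' X₁ : Scheme.{0})
      (f : X₁ ⟶ Spec (.of k)) (q : X' ⟶ X₁) (G : Type) [Group G] [Finite G] (ρ : G →* Aut X'),
      IsSeparated f → LocallyOfFiniteType f → QuasiCompact f → IsIntegral X₁ → IsIntegral X' →
      Scheme.IsRegular X' → IsFinite q → Function.Surjective q.base →
      (∃ U : X₁.Opens, Dense (U : Set X₁) ∧ Etale (q ∣_ U)) → (∀ g : G, (ρ g).hom ≫ q = q) →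
      (∀ x y : X', q.base x = q.base y → ∃ g : G, (ρ g).hom.base x = y) →
      ∀ (Xs : Scheme.{0}) (π : Xs ⟶ X') (ρs : G →* Aut Xs), IsProper π → IsBirational π →
      IsIntegral Xs → Scheme.IsRegular Xs → (∀ g : G, (ρs g).hom ≫ π = π ≫ (ρ g).hom) →
      (∀ x : Xs, HasNormalSylow p (inertiaSubgroup ρs x)) →
      (∀ x : Xs, ∃ U : Xs.Opens, IsAffineOpen U ∧ x ∈ U ∧ ∀ g : G, (ρs g).hom ⁻¹ᵁ U = U) →
      Scheme.HasResolution X₁) :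
    CyclicWildQuotient := by
  intro p hp k _ _ X' X₁ f q G _ _ ρ hcard hsep hft hqc hX₁ hX' hreg hq hsurj hU hρ horb
  haveI : Fact p.Prime := ⟨hp⟩
  have hG : IsPGroup p G := IsPGroup.of_card (n := 1) (by rw [hcard, pow_one])
  exact hasResolution_of_pClosedModel_of_hasNormalSylow hstub p hp k X' X₁ f q G ρ
    (HasNormalSylow.of_isPGroup hG) hsep hft hqc hX₁ hX' hreg hq hsurj hU hρ horb

/-- **`stub_pClosedModel` contains the tame case over every field**: the transfer stub
(hypothesis `hstub`) proves the crux for every `G` of order prime to `p` — no perfectness of `k`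
needed, in contrast to the route item `TameQuotientResolution` as filed — since such a `G` has the
trivial group as normal Sylow `p`-subgroup (`HasNormalSylow.of_not_dvd_card`). [folklore] -/
theorem hasResolution_of_pClosedModel_of_coprime
    (hstub : ∀ (p : ℕ) (_ : p.Prime) (k : Type) [Field k] [CharP k p] (X' X₁ : Scheme.{0})
      (f : X₁ ⟶ Spec (.of k)) (q : X' ⟶ X₁) (G : Type) [Group G] [Finite G] (ρ : G →* Aut X'),
      IsSeparated f → LocallyOfFiniteType f → QuasiCompact f → IsIntegral X₁ → IsIntegral X' →
      Scheme.IsRegular X' → IsFinite q → Function.Surjective q.base →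
      (∃ U : X₁.Opens, Dense (U : Set X₁) ∧ Etale (q ∣_ U)) → (∀ g : G, (ρ g).hom ≫ q = q) →
      (∀ x y : X', q.base x = q.base y → ∃ g : G, (ρ g).hom.base x = y) →
      ∀ (Xs : Scheme.{0}) (π : Xs ⟶ X') (ρs : G →* Aut Xs), IsProper π → IsBirational π →
      IsIntegral Xs → Scheme.IsRegular Xs → (∀ g : G, (ρs g).hom ≫ π = π ≫ (ρ g).hom) →
      (∀ x : Xs, HasNormalSylow p (inertiaSubgroup ρs x)) →
      (∀ x : Xs, ∃ U : Xs.Opens, IsAffineOpen U ∧ x ∈ U ∧ ∀ g : G, (ρs g).hom ⁻¹ᵁ U = U) →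
      Scheme.HasResolution X₁)
    (p : ℕ) (hp : p.Prime) (k : Type) [Field k] [CharP k p] (X' X₁ : Scheme.{0})
    (f : X₁ ⟶ Spec (.of k)) (q : X' ⟶ X₁) (G : Type) [Group G] [Finite G] (ρ : G →* Aut X')
    (hcop : Nat.Coprime (Nat.card G) p)
    (hsep : IsSeparated f) (hft : LocallyOfFiniteType f) (hqc : QuasiCompact f)
    (hX₁ : IsIntegral X₁) (hX' : IsIntegral X') (hreg : Scheme.IsRegular X') (hq : IsFinite q)
    (hsurj : Function.Surjective q.base)
    (hU : ∃ U : X₁.Opens, Dense (U : Set X₁) ∧ Etale (q ∣_ U))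
    (hρ : ∀ g : G, (ρ g).hom ≫ q = q)
    (horb : ∀ x y : X', q.base x = q.base y → ∃ g : G, (ρ g).hom.base x = y) :
    Scheme.HasResolution X₁ := by
  haveI : Fact p.Prime := ⟨hp⟩
  have hG : HasNormalSylow p G := HasNormalSylow.of_not_dvd_card fun hdvd =>
    hp.ne_one ((Nat.coprime_comm.mp hcop).eq_one_of_dvd hdvd)
  exact hasResolution_of_pClosedModel_of_hasNormalSylow hstub p hp k X' X₁ f q G ρ hG hsep hft hqc
    hX₁ hX' hreg hq hsurj hU hρ horb

/-- **`stub_pClosedModel` implies the route item `TameQuotientResolution`**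
(stmt-ResolutionOfSingularities-15645, filed over perfect fields; the stub gives it over every
field, `hasResolution_of_pClosedModel_of_coprime`). [folklore] -/
theorem tameQuotientResolution_of_pClosedModel
    (hstub : ∀ (p : ℕ) (_ : p.Prime) (k : Type) [Field k] [CharP k p] (X' X₁ : Scheme.{0})
      (f : X₁ ⟶ Spec (.of k)) (q : X' ⟶ X₁) (G : Type) [Group G] [Finite G] (ρ : G →* Aut X'),
      IsSeparated f → LocallyOfFiniteType f → QuasiCompact f → IsIntegral X₁ → IsIntegral X' →
      Scheme.IsRegular X' → IsFinite q → Function.Surjective q.base →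
      (∃ U : X₁.Opens, Dense (U : Set X₁) ∧ Etale (q ∣_ U)) → (∀ g : G, (ρ g).hom ≫ q = q) →
      (∀ x y : X', q.base x = q.base y → ∃ g : G, (ρ g).hom.base x = y) →
      ∀ (Xs : Scheme.{0}) (π : Xs ⟶ X') (ρs : G →* Aut Xs), IsProper π → IsBirational π →
      IsIntegral Xs → Scheme.IsRegular Xs → (∀ g : G, (ρs g).hom ≫ π = π ≫ (ρ g).hom) →
      (∀ x : Xs, HasNormalSylow p (inertiaSubgroup ρs x)) →
      (∀ x : Xs, ∃ U : Xs.Opens, IsAffineOpen U ∧ x ∈ U ∧ ∀ g : G, (ρs g).hom ⁻¹ᵁ U = U) →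
      Scheme.HasResolution X₁) :
    TameQuotientResolution :=
  fun p hp k _ _ _ X' X₁ f q G _ _ ρ hcop hsep hft hqc hX₁ hX' hreg hq hsurj hU hρ horb =>
    hasResolution_of_pClosedModel_of_coprime hstub p hp k X' X₁ f q G ρ hcop hsep hft hqc hX₁ hX'
      hreg hq hsurj hU hρ horb

/-! ## The reshaped p-closed stub `stub_pClosedWQ` (skeleton `Sketch`, cycle 2, sha 4d520a71…)

In cycle 2 the transfer stub was split into classical quotient glue (`stub_quotientModel`,
`stub_birational_of_bijective`) and the p-closed sub-problem `stub_pClosedWQ` — the crux verbatim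
plus "every inertia group has a normal Sylow `p`-subgroup", with NO auxiliary model. The
hypothesis `hWQp` below is its registered signature, universally closed, verbatim. -/

/-- **The old transfer stub implies the new p-closed stub**: `stub_pClosedModel` (hypothesis
`hstub`) gives `stub_pClosedWQ` (conclusion, binders verbatim) through the identity model of
`phaseZero_of_forall_hasNormalSylow` — so the cycle-2 reshape did not weaken the line's open
obligation. [folklore] -/
theorem pClosedWQ_of_pClosedModel
    (hstub : ∀ (p : ℕ) (_ : p.Prime) (k : Type) [Field k] [CharP k p] (X' X₁ : Scheme.{0})
      (f : X₁ ⟶ Spec (.of k)) (q : X' ⟶ X₁) (G : Type) [Group G] [Finite G] (ρ : G →* Aut X'),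
      IsSeparated f → LocallyOfFiniteType f → QuasiCompact f → IsIntegral X₁ → IsIntegral X' →
      Scheme.IsRegular X' → IsFinite q → Function.Surjective q.base →
      (∃ U : X₁.Opens, Dense (U : Set X₁) ∧ Etale (q ∣_ U)) → (∀ g : G, (ρ g).hom ≫ q = q) →
      (∀ x y : X', q.base x = q.base y → ∃ g : G, (ρ g).hom.base x = y) →
      ∀ (Xs : Scheme.{0}) (π : Xs ⟶ X') (ρs : G →* Aut Xs), IsProper π → IsBirational π →
      IsIntegral Xs → Scheme.IsRegular Xs → (∀ g : G, (ρs g).hom ≫ π = π ≫ (ρ g).hom) →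
      (∀ x : Xs, HasNormalSylow p (inertiaSubgroup ρs x)) →
      (∀ x : Xs, ∃ U : Xs.Opens, IsAffineOpen U ∧ x ∈ U ∧ ∀ g : G, (ρs g).hom ⁻¹ᵁ U = U) →
      Scheme.HasResolution X₁)
    (p : ℕ) (hp : p.Prime) (k : Type) [Field k] [CharP k p]
    (X' X₁ : Scheme.{0}) (f : X₁ ⟶ Spec (.of k)) (q : X' ⟶ X₁) (G : Type) [Group G] [Finite G]
    (ρ : G →* Aut X') (hsep : IsSeparated f) (hft : LocallyOfFiniteType f) (hqc : QuasiCompact f)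
    (hX₁ : IsIntegral X₁) (hX' : IsIntegral X') (hreg : Scheme.IsRegular X') (hq : IsFinite q)
    (hsurj : Function.Surjective q.base)
    (hU : ∃ U : X₁.Opens, Dense (U : Set X₁) ∧ Etale (q ∣_ U))
    (hρ : ∀ g : G, (ρ g).hom ≫ q = q)
    (horb : ∀ x y : X', q.base x = q.base y → ∃ g : G, (ρ g).hom.base x = y)
    (hNpS : ∀ x : X', HasNormalSylow p (inertiaSubgroup ρ x)) :
    Scheme.HasResolution X₁ :=
  hasResolution_of_pClosedModel_of_forall_hasNormalSylow hstub p hp k X' X₁ f q G ρ hsep hft hqc hX₁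
    hX' hreg hq hsurj hU hρ horb hNpS

/-- **`stub_pClosedWQ` proves the crux for a p-closed group**: if the p-closed sub-problem holds
(hypothesis `hWQp`, its registered signature verbatim) then the crux holds for every `G` with a
normal Sylow `p`-subgroup, since inertia groups are subgroups (`HasNormalSylow.subgroup`).
[folklore] -/
theorem hasResolution_of_pClosedWQ_of_hasNormalSylow
    (hWQp : ∀ (p : ℕ) (_ : p.Prime) (k : Type) [Field k] [CharP k p] (X' X₁ : Scheme.{0})
      (f : X₁ ⟶ Spec (.of k)) (q : X' ⟶ X₁) (G : Type) [Group G] [Finite G] (ρ : G →* Aut X'),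
      IsSeparated f → LocallyOfFiniteType f → QuasiCompact f → IsIntegral X₁ → IsIntegral X' →
      Scheme.IsRegular X' → IsFinite q → Function.Surjective q.base →
      (∃ U : X₁.Opens, Dense (U : Set X₁) ∧ Etale (q ∣_ U)) → (∀ g : G, (ρ g).hom ≫ q = q) →
      (∀ x y : X', q.base x = q.base y → ∃ g : G, (ρ g).hom.base x = y) →
      (∀ x : X', HasNormalSylow p (inertiaSubgroup ρ x)) → Scheme.HasResolution X₁)
    (p : ℕ) (hp : p.Prime) (k : Type) [Field k] [CharP k p]
    (X' X₁ : Scheme.{0}) (f : X₁ ⟶ Spec (.of k)) (q : X' ⟶ X₁) (G : Type) [Group G] [Finite G]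
    (ρ : G →* Aut X') (hG : haveI : Fact p.Prime := ⟨hp⟩; HasNormalSylow p G)
    (hsep : IsSeparated f) (hft : LocallyOfFiniteType f) (hqc : QuasiCompact f)
    (hX₁ : IsIntegral X₁) (hX' : IsIntegral X') (hreg : Scheme.IsRegular X') (hq : IsFinite q)
    (hsurj : Function.Surjective q.base)
    (hU : ∃ U : X₁.Opens, Dense (U : Set X₁) ∧ Etale (q ∣_ U))
    (hρ : ∀ g : G, (ρ g).hom ≫ q = q)
    (horb : ∀ x y : X', q.base x = q.base y → ∃ g : G, (ρ g).hom.base x = y) :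
    Scheme.HasResolution X₁ :=
  haveI : Fact p.Prime := ⟨hp⟩
  hWQp p hp k X' X₁ f q G ρ hsep hft hqc hX₁ hX' hreg hq hsurj hU hρ horb fun _ => hG.subgroup _

/-- **`stub_pClosedWQ` contains the wild atom**: the p-closed sub-problem (hypothesis `hWQp`, its
registered signature verbatim) implies the route item `CyclicWildQuotient`
(stmt-ResolutionOfSingularities-15644, OPEN from dimension 4): a group of order `p` is a
`p`-group, hence p-closed. [folklore] -/
theorem cyclicWildQuotient_of_pClosedWQ
    (hWQp : ∀ (p : ℕ) (_ : p.Prime) (k : Type) [Field k] [CharP k p] (X' X₁ : Scheme.{0})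
      (f : X₁ ⟶ Spec (.of k)) (q : X' ⟶ X₁) (G : Type) [Group G] [Finite G] (ρ : G →* Aut X'),
      IsSeparated f → LocallyOfFiniteType f → QuasiCompact f → IsIntegral X₁ → IsIntegral X' →
      Scheme.IsRegular X' → IsFinite q → Function.Surjective q.base →
      (∃ U : X₁.Opens, Dense (U : Set X₁) ∧ Etale (q ∣_ U)) → (∀ g : G, (ρ g).hom ≫ q = q) →
      (∀ x y : X', q.base x = q.base y → ∃ g : G, (ρ g).hom.base x = y) →
      (∀ x : X', HasNormalSylow p (inertiaSubgroup ρ x)) → Scheme.HasResolution X₁) :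
    CyclicWildQuotient := by
  intro p hp k _ _ X' X₁ f q G _ _ ρ hcard hsep hft hqc hX₁ hX' hreg hq hsurj hU hρ horb
  haveI : Fact p.Prime := ⟨hp⟩
  have hG : IsPGroup p G := IsPGroup.of_card (n := 1) (by rw [hcard, pow_one])
  exact hasResolution_of_pClosedWQ_of_hasNormalSylow hWQp p hp k X' X₁ f q G ρ
    (HasNormalSylow.of_isPGroup hG) hsep hft hqc hX₁ hX' hreg hq hsurj hU hρ horb

/-- **`stub_pClosedWQ` contains the tame case over every field**: the p-closed sub-problem
(hypothesis `hWQp`) proves the crux for every `G` of order prime to `p`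
(`HasNormalSylow.of_not_dvd_card`), with no perfectness assumption on `k`. [folklore] -/
theorem hasResolution_of_pClosedWQ_of_coprime
    (hWQp : ∀ (p : ℕ) (_ : p.Prime) (k : Type) [Field k] [CharP k p] (X' X₁ : Scheme.{0})
      (f : X₁ ⟶ Spec (.of k)) (q : X' ⟶ X₁) (G : Type) [Group G] [Finite G] (ρ : G →* Aut X'),
      IsSeparated f → LocallyOfFiniteType f → QuasiCompact f → IsIntegral X₁ → IsIntegral X' →
      Scheme.IsRegular X' → IsFinite q → Function.Surjective q.base →
      (∃ U : X₁.Opens, Dense (U : Set X₁) ∧ Etale (q ∣_ U)) → (∀ g : G, (ρ g).hom ≫ q = q) →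
      (∀ x y : X', q.base x = q.base y → ∃ g : G, (ρ g).hom.base x = y) →
      (∀ x : X', HasNormalSylow p (inertiaSubgroup ρ x)) → Scheme.HasResolution X₁)
    (p : ℕ) (hp : p.Prime) (k : Type) [Field k] [CharP k p] (X' X₁ : Scheme.{0})
    (f : X₁ ⟶ Spec (.of k)) (q : X' ⟶ X₁) (G : Type) [Group G] [Finite G] (ρ : G →* Aut X')
    (hcop : Nat.Coprime (Nat.card G) p)
    (hsep : IsSeparated f) (hft : LocallyOfFiniteType f) (hqc : QuasiCompact f)
    (hX₁ : IsIntegral X₁) (hX' : IsIntegral X') (hreg : Scheme.IsRegular X') (hq : IsFinite q)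
    (hsurj : Function.Surjective q.base)
    (hU : ∃ U : X₁.Opens, Dense (U : Set X₁) ∧ Etale (q ∣_ U))
    (hρ : ∀ g : G, (ρ g).hom ≫ q = q)
    (horb : ∀ x y : X', q.base x = q.base y → ∃ g : G, (ρ g).hom.base x = y) :
    Scheme.HasResolution X₁ := by
  haveI : Fact p.Prime := ⟨hp⟩
  have hG : HasNormalSylow p G := HasNormalSylow.of_not_dvd_card fun hdvd =>
    hp.ne_one ((Nat.coprime_comm.mp hcop).eq_one_of_dvd hdvd)
  exact hasResolution_of_pClosedWQ_of_hasNormalSylow hWQp p hp k X' X₁ f q G ρ hG hsep hft hqc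
    hX₁ hX' hreg hq hsurj hU hρ horb

/-- **`stub_pClosedWQ` implies the route item `TameQuotientResolution`**
(stmt-ResolutionOfSingularities-15645; filed over perfect fields, obtained here over every field).
[folklore] -/
theorem tameQuotientResolution_of_pClosedWQ
    (hWQp : ∀ (p : ℕ) (_ : p.Prime) (k : Type) [Field k] [CharP k p] (X' X₁ : Scheme.{0})
      (f : X₁ ⟶ Spec (.of k)) (q : X' ⟶ X₁) (G : Type) [Group G] [Finite G] (ρ : G →* Aut X'),
      IsSeparated f → LocallyOfFiniteType f → QuasiCompact f → IsIntegral X₁ → IsIntegral X' →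
      Scheme.IsRegular X' → IsFinite q → Function.Surjective q.base →
      (∃ U : X₁.Opens, Dense (U : Set X₁) ∧ Etale (q ∣_ U)) → (∀ g : G, (ρ g).hom ≫ q = q) →
      (∀ x y : X', q.base x = q.base y → ∃ g : G, (ρ g).hom.base x = y) →
      (∀ x : X', HasNormalSylow p (inertiaSubgroup ρ x)) → Scheme.HasResolution X₁) :
    TameQuotientResolution :=
  fun p hp k _ _ _ X' X₁ f q G _ _ ρ hcop hsep hft hqc hX₁ hX' hreg hq hsurj hU hρ horb =>
    hasResolution_of_pClosedWQ_of_coprime hWQp p hp k X' X₁ f q G ρ hcop hsep hft hqc hX₁ hX'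
      hreg hq hsurj hU hρ horb

/-! ## The p-closed stub is not stronger than the summit -/

/-- **`stub_pClosedWQ` is implied by the summit**: resolution of singularities in characteristic
`p` resolves `X₁` directly (it is reduced, separated and of finite type over `k`), whatever the
group datum. So the statement to be promoted sits between the open route item
`CyclicWildQuotient` and the summit `ResolutionOfSingularities` — a genuine sub-problem, not a
strengthening of the conjecture. [folklore] -/
theorem pClosedWQ_of_resolutionOfSingularities (h : _root_.ResolutionOfSingularities)
    (p : ℕ) (hp : p.Prime) (k : Type) [Field k] [CharP k p]
    (X' X₁ : Scheme.{0}) (f : X₁ ⟶ Spec (.of k)) (q : X' ⟶ X₁) (G : Type) [Group G] [Finite G]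
    (ρ : G →* Aut X') (hsep : IsSeparated f) (hft : LocallyOfFiniteType f) (hqc : QuasiCompact f)
    (hX₁ : IsIntegral X₁) (_hX' : IsIntegral X') (_hreg : Scheme.IsRegular X') (_hq : IsFinite q)
    (_hsurj : Function.Surjective q.base)
    (_hU : ∃ U : X₁.Opens, Dense (U : Set X₁) ∧ Etale (q ∣_ U))
    (_hρ : ∀ g : G, (ρ g).hom ≫ q = q)
    (_horb : ∀ x y : X', q.base x = q.base y → ∃ g : G, (ρ g).hom.base x = y)
    (_hNpS : ∀ x : X', HasNormalSylow p (inertiaSubgroup ρ x)) :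
    Scheme.HasResolution X₁ :=
  haveI := hX₁
  (_root_.ResolutionOfSingularities_iff.mp h) p hp k X₁ f hsep hft hqc inferInstance

end Summit.ResolutionOfSingularities.ResolutionOfSingularities.Theorems.WildQuotientResolution.PClosedCase
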